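import Summits.CriticalPhenomena.PercolationContinuityZ3.Theorems.PercNearOneGluingNoHeavyLowerTailCILGluedPairOneSided
import Summits.CriticalPhenomena.PercolationContinuityZ3.Theorems.PercNearOneGluingNoHeavyLowerTailHullPortDepthTwo
import HarnessLib

/-!
# `NoHeavyLowerTail` (stmt-CriticalPhenomena-4575) — CIL for a depth-two observer with two non-relay neighbours under the
# one-sided reference

Support file (prover `prim-hp-3`, hull-port line; `--supports stmt-CriticalPhenomena-4575`).  No definitions, no named
facts, no sorries.  Notation as in `…CILGluedPairOneSided` and `…HullPortDepthTwo`: `H = G − o` (pairs at the observer `o`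
switched off, `w ∖ o`), `H`-lightness `s(y)`, `CS_H(B, b)`.

`HullPort.cil_depthTwo_of_split` (prover `prim-hp-1`) reduces CIL at a depth-two observer `o` (non-relay neighbours are
relay-neighboured in `H`) with a witness `b` dominating all relay neighbours of `o` and of its non-relay neighbours to the split
inequalities `CS_H(B, b)`, `B` a set of ≥ 2 non-relay neighbours.  With exactly two non-relay neighbours `x, y` one inequality is
left, `CS_H({x,y}, b)`, and `HullPort.setCS_pair_of_oneSided` proves it under the ONE-SIDED hypotheses in `H − y`: the ports of
`y` are dominated by `b` there, and `b` is a valid witness for `x` there (e.g. `HullPort.cil_of_portDomination_scaled`).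

* `HullPort.cil_depthTwo_pair_oneSided` — the assembled statement: `μ{1 ≤ N ≤ j} ≤ μ{|π(b)| ≤ j}` at such an observer.
  Exact census (seat folder lab/menu2.py, n ≤ 9): together with its mirror image (`x ↔ y`) and the plain single-star criteria,
  some relay `b` satisfies these hypotheses in 1 563 of 1 566 observers with two light relay-neighboured non-relay neighbours;
  the residual 3 instances need the two-sided reference `H` (the cell's open kernel).
-/

noncomputable section

namespace Summit.CriticalPhenomena.PercolationContinuityZ3.Theorems

open MeasureTheory Set Literature.Probability.LatticeModels Literature.Probability.Percolation
open scoped Classical BigOperators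

variable {n : ℕ}

namespace HullPort

/-- **CIL for a depth-two observer with two non-relay neighbours, one-sided reference.**  Let `o ∉ A` have positive-weight
neighbours: relays, and exactly two non-relays `x ≠ y`, each relay-neighboured in `H = G − o`.  Let `b ∈ A` be at least as
`H`-light as every relay adjacent to `o`, `x` or `y` (as in `HullPort.cil_depthTwo_of_split`), and suppose in addition, in the
graph `H − y` (pairs at `o` and at `y` switched off): every port of `y` is at least as light as `b`, and `b` is a valid witness
for `x` (`bad_{H−y}(x) ≤ I_{H−y}(b)`; e.g. by `HullPort.cil_of_portDomination_scaled`).  Then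
`μ{1 ≤ N ≤ j} ≤ μ{|π(b)| ≤ j}` — the conclusion of `stub_cumulativeIsolation` at `o` with witness `b`.
The only star needing work, `{x, y}`, is `setCS_pair_of_oneSided`. [this file] -/
theorem cil_depthTwo_pair_oneSided (w : Sym2 (Fin n) → unitInterval) (A : Finset (Fin n)) (o x y : Fin n) (j : ℕ)
    (hoA : o ∉ A) (hxy : x ≠ y) (hxo : x ≠ o) (hyo : y ≠ o) (hxA : x ∉ A) (hyA : y ∉ A)
    (honly : ∀ v, v ≠ o → v ∉ A → w s(o, v) ≠ 0 → v = x ∨ v = y)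
    (hdepth : ∀ v, v ≠ o → v ∉ A → w s(o, v) ≠ 0 → ∀ u, u ≠ o → w s(v, u) ≠ 0 → u ∈ A)
    (b : Fin n) (hbA : b ∈ A)
    (hdomO : ∀ q ∈ A, w s(o, q) ≠ 0 →
      (prodBernoulli w).real {ω : BondConfig (Fin n) |
          (A.filter fun z => (openGraph (ω ∩ {e | o ∉ e})).Reachable q z).card ≤ j} ≤
        (prodBernoulli w).real {ω : BondConfig (Fin n) |
          (A.filter fun z => (openGraph (ω ∩ {e | o ∉ e})).Reachable b z).card ≤ j})
    (hdomX : ∀ v, v ≠ o → v ∉ A → w s(o, v) ≠ 0 → ∀ q ∈ A, w s(v, q) ≠ 0 →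
      (prodBernoulli w).real {ω : BondConfig (Fin n) |
          (A.filter fun z => (openGraph (ω ∩ {e | o ∉ e})).Reachable q z).card ≤ j} ≤
        (prodBernoulli w).real {ω : BondConfig (Fin n) |
          (A.filter fun z => (openGraph (ω ∩ {e | o ∉ e})).Reachable b z).card ≤ j})
    (hdomY : ∀ q, q ≠ y → w s(y, q) ≠ 0 → q ≠ o →
      (prodBernoulli fun e => if e ∈ {e : Sym2 (Fin n) | y ∉ e} then
          (if e ∈ {e : Sym2 (Fin n) | o ∉ e} then w e else 0) else 0).real
          {ω : BondConfig (Fin n) | (A.filter fun z => ω ∈ openConn q z).card ≤ j} ≤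
        (prodBernoulli fun e => if e ∈ {e : Sym2 (Fin n) | y ∉ e} then
          (if e ∈ {e : Sym2 (Fin n) | o ∉ e} then w e else 0) else 0).real
          {ω : BondConfig (Fin n) | (A.filter fun z => ω ∈ openConn b z).card ≤ j})
    (hvalidX : (prodBernoulli fun e => if e ∈ {e : Sym2 (Fin n) | y ∉ e} then
          (if e ∈ {e : Sym2 (Fin n) | o ∉ e} then w e else 0) else 0).real
        {ω : BondConfig (Fin n) | 1 ≤ (A.filter fun z => ω ∈ openConn x z).card ∧
          (A.filter fun z => ω ∈ openConn x z).card ≤ j} ≤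
      (prodBernoulli fun e => if e ∈ {e : Sym2 (Fin n) | y ∉ e} then
          (if e ∈ {e : Sym2 (Fin n) | o ∉ e} then w e else 0) else 0).real
        {ω : BondConfig (Fin n) | (A.filter fun z => ω ∈ openConn b z).card ≤ j}) :
    (prodBernoulli w).real {ω : BondConfig (Fin n) |
        1 ≤ (A.filter fun z => ω ∈ openConn o z).card ∧ (A.filter fun z => ω ∈ openConn o z).card ≤ j} ≤
      (prodBernoulli w).real {ω : BondConfig (Fin n) | (A.filter fun z => ω ∈ openConn b z).card ≤ j} := by
  refine cil_depthTwo_of_split w A o j hoA hdepth b hbA hdomO hdomX ?_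
  intro B hcard hB
  -- the only Steiner star with two members is `{x, y}`
  have hBsub : B ⊆ ({x, y} : Finset (Fin n)) := by
    intro v hv
    obtain ⟨hvo, hvA, hwv⟩ := hB v hv
    rcases honly v hvo hvA hwv with h | h
    · rw [h]; simp
    · rw [h]; simp
  have hcard2 : ({x, y} : Finset (Fin n)).card ≤ B.card := by
    rw [Finset.card_pair hxy]; exact hcard
  have hBeq : B = {x, y} := Finset.eq_of_subset_of_card_le hBsub hcard2
  rw [hBeq]
  apply setCS_avoid_of_off
  set u : Sym2 (Fin n) → unitInterval := fun e => if e ∈ {e : Sym2 (Fin n) | o ∉ e} then w e else 0 with hu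
  have huy : ∀ v, v ≠ o → u s(y, v) = w s(y, v) := by
    intro v hv
    have : o ∉ s(y, v) := by
      rw [Sym2.mem_iff, not_or]; exact ⟨hyo.symm, hv.symm⟩
    simp only [hu, mem_setOf_eq, this, not_false_eq_true, if_true]
  have huyo : u s(y, o) = 0 := by
    simp only [hu, mem_setOf_eq, Sym2.mem_iff, or_true, not_true_eq_false, if_false]
  have hwy : w s(o, y) ≠ 0 := by
    -- `y` is a genuine neighbour: it lies in the star `B`
    have hyB : y ∈ B := by rw [hBeq]; simp
    exact (hB y hyB).2.2
  refine setCS_pair_of_oneSided u A x y b j hxy hxA hyA hbA ?_ hvalidX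
  intro q hqy huq
  have hqo : q ≠ o := by rintro rfl; exact huq huyo
  rw [huy q hqo] at huq
  exact ⟨hdepth y hyo hyA hwy q hqo huq, hdomY q hqy huq hqo⟩

end HullPort

end Summit.CriticalPhenomena.PercolationContinuityZ3.Theorems

end
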